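import Summits.Ventures.HSemireg.WedgeWeilMirror
import Literature.AlgebraicGeometry.Motives.RigidityIndexEven

/-!
# Venture HSemireg — the parity law at the self-dual degree: odd-m wedge ranks are even (W-PURITY(ρ) Step 1)

HONEST FRAMING. Part of the Lean index of the computation cell `pub-hsemireg` (second enclosure wave, cut by seat p6 in the
conventions of seat p3's ENCLOSURE-PLAN-p3.md / build.py from th-7's kernel assets).  Finite-dimensional exterior algebra over a field ONLY:
no variety, no cohomology theory, no semiregularity map is constructed here; nothing here says that HC / HC_CM / HC_AV holds;
no Literature fact is declared or used.  The geometric DICTIONARY (why these ranks are the `HT`-side box ranks of the cell's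
STRUCTURE.md §1 / theory/FORMULA-N.md) lives in theory/FORMULA-N-th7.md PART B §A.3 / §N and is NOT asserted in Lean.

th-7's PART F — THE PARITY LAW AT THE SELF-DUAL DEGREE = W-PURITY(ρ) STEP 1 (theory/th7/WeilPurity.lean v4 sha256/16 41befba5ae41ea8f (th-7 g6, 23:14Z 2026-08-22; = v3.2 + one import + PART F; ×2 farm rc 0 + axioms standard + negative control NC-F1 rc 1 at p6 g7 23:3xZ), l.7077–7239), VERBATIM up
to namespaces (`HSemiregHankel` ↦ `….Wedge.Hankel`, `HSemiregWeilPurity` ↦ `….Wedge.WeilPurity` as in the other wave-2 files): for `v ∈ ⋀^d(K^I)` and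
`|I| = m + d + m`, the rank of `θ ↦ θ ∧ v` on `⋀^m` is the rank of the GRAM MATRIX `gmat v m` (`G(S,T)` = top coefficient of `E_S · v · E_T`; `gmat_eq` /
`rank_gmat` via PART D's `cmat`), `G(T,S) = (−1)^{m·m} G(S,T)`, `G(S,S) = 0` (`gmat_swap`, `gmat_diag`); so for ODD `m` the matrix is alternating and its rank is
EVEN (`even_rank_of_alt` = matrix form of the TREE theorem `Literature.AlgebraicGeometry.Motives.exists_finrank_eq_finrank_ker_add_two_mul`, this file's one
Literature import).  MAIN: **`even_finrank_range_wedge_middle`** (`m` odd, `m + d + m = 2n`, `v ∈ ⋀^d(K^{2n})` ⇒ `Even (finrank range(θ ↦ θ ∧ v ∣ ⋀^m))`);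
COROLLARY **`weilRank_nn_middle_even`** (Weil type `(n,n)`, `n` ODD, ANY `q, a, b`, any field: the degree-`n` rank of `θ ↦ θ ∧ vW` is even — every purity drop at
odd `n` is even: 94 → 92 / 112 → 110 at n = 3, 1254 → 1252 at n = 5).  INDEPENDENT ×2 (second kernel proof of the same two statements by another route —
quotient by the kernel + `Literature.GroupTheory.FiniteAbelian.even_finrank_of_isAlt_of_nondegenerate`; NOT filed): p6 g7 HOME/lean/enclosure/wave2/x2-not-filed/
AlternatingRank.lean c25a24316ea4bafe + WedgeRankParity.lean 85e33b3d10333857 (`even_rank_of_alternating`, `even_finrank_range_wedge_of_odd`).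
-/

open Module Set Set.powersetCard

/-! ## PART F — THE PARITY LAW AT THE SELF-DUAL DEGREE (th-7 g6 = literature-prover-pub-hsemireg-th-7-g6-0, 2026-08-22/23).
W-PURITY(ρ) STEP 1 (theory/th7/W-PURITY-RHO-DERIVATION-th7.md §2): for `v ∈ ⋀^d(K^I)` and `|I| = m + d + m`, the rank of
`θ ↦ θ ∧ v` on `⋀^m` is the rank of the GRAM MATRIX `G(S,T) = top coefficient of E_S · v · E_T` (`|S| = |T| = m`), because
`G` is the coordinate matrix of PART D with its rows reindexed by complements, transposed and column-scaled by the units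
`u(Tᶜ,T)` (`gmat_eq`, `rank_gmat`). `G(T,S) = (−1)^{m·m} G(S,T)` and `G(S,S) = 0` (`gmat_swap`, `gmat_diag`; parity-only
graded commutativity, ANY `d`, ANY field), so for ODD `m` the matrix `G` is alternating and its rank is EVEN (`even_rank_of_alt`
= matrix form of the TREE theorem `Literature.AlgebraicGeometry.Motives.exists_finrank_eq_finrank_ker_add_two_mul`, imported).
MAIN: `Wedge.Hankel.even_finrank_range_wedge_middle` — `m` odd, `m + d + m = 2n`, `v ∈ ⋀^d(K^{2n})` ⇒
`Even (finrank range(θ ↦ θ ∧ v ∣ ⋀^m))`; COROLLARY `Wedge.WeilPurity.weilRank_nn_middle_even` — Weil type `(n,n)` with `n` odd,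
ANY `q, a, b` (any Hankel rank ρ): the degree-`n` rank is even, hence EVERY purity drop at odd `n` is even (the double branches
of FORMULA-N PART B §L.5 / the n = 3, 5 data: 94 → 92, 112 → 110, 1254 → 1252). Nothing here bears on HC / HC_CM / HC_AV. -/

namespace Summit.Ventures.HSemireg.Wedge.Hankel

section Parity

variable (K : Type*) [Field K] {I : Type*} [LinearOrder I] [Fintype I]

open Matrix in
/-- An ALTERNATING square matrix over a field (skew entries, zero diagonal — any characteristic) has EVEN rank:
matrix form of the tree theorem `exists_finrank_eq_finrank_ker_add_two_mul` (alternating bilinear forms have even rank),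
via `Matrix.toLinearMap₂'`, `ker = ker(Mᵀ *ᵥ ·)` and rank–nullity. [folklore] -/
theorem even_rank_of_alt {ι : Type*} [Fintype ι] [DecidableEq ι] (M : Matrix ι ι K)
    (hskew : ∀ i j, M i j = -M j i) (hdiag : ∀ i, M i i = 0) : Even M.rank := by
  classical
  set Bf : LinearMap.BilinForm K (ι → K) := Matrix.toLinearMap₂' K M with hBf
  have halt : Bf.IsAlt := by
    intro x
    rw [hBf, Matrix.toLinearMap₂'_apply, ← Finset.sum_product']
    refine Finset.sum_ninvolution (fun p : ι × ι => (p.2, p.1)) ?_ ?_ (fun _ => Finset.mem_univ _) ?_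
    · intro p
      rw [hskew p.2 p.1, smul_eq_mul, smul_eq_mul, smul_eq_mul, smul_eq_mul]
      ring
    · rintro ⟨i, j⟩ h
      simp only [ne_eq, Prod.mk.injEq, not_and]
      rintro rfl
      exact (h (by rw [hdiag, smul_zero, smul_zero])).elim
    · intro p; rfl
  obtain ⟨k, hk⟩ := Literature.AlgebraicGeometry.Motives.exists_finrank_eq_finrank_ker_add_two_mul Bf halt
  have hker : LinearMap.ker Bf = LinearMap.ker (Matrix.mulVecLin Mᵀ) := by
    ext x
    simp only [LinearMap.mem_ker, Matrix.mulVecLin_apply, Matrix.mulVec_transpose]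
    constructor
    · intro h
      funext j
      have h1 := LinearMap.congr_fun h (Pi.single j 1)
      rw [hBf, Matrix.toLinearMap₂'_apply', LinearMap.zero_apply, dotProduct_mulVec,
        dotProduct_single, mul_one] at h1
      exact h1
    · intro h
      refine LinearMap.ext fun y => ?_
      rw [hBf, Matrix.toLinearMap₂'_apply', dotProduct_mulVec, h, zero_dotProduct,
        LinearMap.zero_apply]
  have hrn := LinearMap.finrank_range_add_finrank_ker (Matrix.mulVecLin Mᵀ)
  rw [← hker, Module.finrank_fintype_fun_eq_card] at hrn
  rw [Module.finrank_fintype_fun_eq_card] at hk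
  have hr : M.rank = Module.finrank K (LinearMap.range (Matrix.mulVecLin Mᵀ)) := by
    rw [← Matrix.rank_transpose M]; rfl
  exact ⟨k, by omega⟩

variable (I) in
/-- the GRAM MATRIX of the middle-degree pairing: `G(S,T)` = top coefficient of `E_S · v · E_T` (`|S| = |T| = m`) -/
noncomputable def gmat (v : HT K I) (m : ℕ) : Matrix (Psc I m) (Psc I m) K :=
  Matrix.of fun S T => (B K I).coord Finset.univ (B K I (S : Finset I) * v * B K I (T : Finset I))

/-- unfolding of the Gram matrix: `G(S,T)` = top coefficient of `E_S · v · E_T`. -/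
lemma gmat_apply (v : HT K I) (m : ℕ) (S T : Psc I m) :
    gmat K I v m S T = (B K I).coord Finset.univ (B K I (S : Finset I) * v * B K I (T : Finset I)) := rfl

/-- `G = (cmat with rows reindexed by complements)ᵀ · diag(u(Tᶜ,T))` -/
lemma gmat_eq {d m : ℕ} (hI : m + d + m = Fintype.card I) {v : HT K I} (hv : v ∈ Hom K I Finset.univ d) :
    gmat K I v m =
      ((cmat K I v (m + d) m).submatrix (cplEquiv (show m + (m + d) = Fintype.card I by omega))
          (Equiv.refl (Psc I m))).transpose *
        Matrix.diagonal (fun T : Psc I m => u K ((T : Finset I)ᶜ) (T : Finset I)) := by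
  ext S T
  rw [Matrix.mul_diagonal, Matrix.transpose_apply, Matrix.submatrix_apply, Equiv.refl_apply, cplEquiv_apply,
    cmat_apply, coe_cpl, gmat_apply]
  have hx : B K I (S : Finset I) * v ∈ Hom K I Finset.univ (m + d) :=
    mul_mem_Hom K (B_mem_Hom K (Finset.subset_univ _) S.2) hv
  have hTc : ((T : Finset I)ᶜ).card = m + d := by rw [Finset.card_compl, T.2]; omega
  have h := coord_univ_mul_B_compl K hx hTc
  rw [compl_compl] at h
  rw [h, mul_comm]

/-- the rank of the Gram matrix is the dimension of `(Hom_m) · v` -/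
lemma rank_gmat {d m : ℕ} (hI : m + d + m = Fintype.card I) {v : HT K I} (hv : v ∈ Hom K I Finset.univ d) :
    (gmat K I v m).rank = Module.finrank K ((Hom K I Finset.univ m).map (LinearMap.mulRight K v)) := by
  classical
  have hc : IsUnit (Matrix.diagonal (fun T : Psc I m => u K ((T : Finset I)ᶜ) (T : Finset I))).det := by
    rw [Matrix.det_diagonal, isUnit_iff_ne_zero, Finset.prod_ne_zero_iff]
    intro T _
    exact (u_ne_zero_iff K).mpr disjoint_compl_left
  rw [gmat_eq K hI hv, Matrix.rank_mul_eq_left_of_isUnit_det _ _ hc, Matrix.rank_transpose, Matrix.rank_submatrix,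
    rank_cmat K v hv m]

/-- `v · E_S = (−1)^{m d} E_S · v` -/
lemma mul_B_eq_of_mem_Hom {d m : ℕ} {v : HT K I} (hv : v ∈ Hom K I Finset.univ d) (S : Psc I m) :
    v * B K I (S : Finset I) = ((-1 : K) ^ (m * d)) • (B K I (S : Finset I) * v) := by
  rw [B_mul_comm_of_mem_Hom K hv (S : Finset I), S.2, smul_smul, ← pow_add, ← two_mul, pow_mul, neg_one_sq,
    one_pow, one_smul]

/-- `G(S,T) = (−1)^{m·m} G(T,S)` (any `d`, any field) -/
lemma gmat_swap {d m : ℕ} {v : HT K I} (hv : v ∈ Hom K I Finset.univ d) (S T : Psc I m) :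
    gmat K I v m S T = ((-1 : K) ^ (m * m)) * gmat K I v m T S := by
  rw [gmat_apply, gmat_apply]
  have hx : B K I (T : Finset I) * v ∈ Hom K I Finset.univ (m + d) :=
    mul_mem_Hom K (B_mem_Hom K (Finset.subset_univ _) T.2) hv
  have h2 : B K I (S : Finset I) * (B K I (T : Finset I) * v) =
      ((-1 : K) ^ (m * (m + d))) • (B K I (T : Finset I) * v * B K I (S : Finset I)) := by
    rw [B_mul_comm_of_mem_Hom K hx (S : Finset I), S.2]
  rw [mul_assoc (B K I (S : Finset I)) v, mul_B_eq_of_mem_Hom K hv T, mul_smul_comm, h2, smul_smul, map_smul,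
    smul_eq_mul]
  congr 1
  have e : (-1 : K) ^ (2 * (m * d)) = 1 := by rw [pow_mul, neg_one_sq, one_pow]
  rw [← pow_add, show m * d + m * (m + d) = m * m + 2 * (m * d) by ring, pow_add, e, mul_one]

/-- `G(S,S) = 0` as soon as `m ≥ 1` (`E_S · E_S = 0`) -/
lemma gmat_diag {d m : ℕ} (hm : 0 < m) {v : HT K I} (hv : v ∈ Hom K I Finset.univ d) (S : Psc I m) :
    gmat K I v m S S = 0 := by
  have hnd : ¬ Disjoint (S : Finset I) (S : Finset I) := by
    rw [Finset.disjoint_self_iff_empty]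
    intro h
    have h2 := S.2
    rw [h, Finset.card_empty] at h2
    omega
  rw [gmat_apply, mul_assoc, mul_B_eq_of_mem_Hom K hv S, mul_smul_comm, ← mul_assoc, B_mul_B, u_eq_zero K hnd,
    zero_smul, zero_mul, smul_zero, map_zero]

/-- **PARITY LAW (abstract form)**: `m` odd, `|I| = m + d + m`, `v ∈ Hom_d` ⇒ `dim (Hom_m · v)` is even. -/
theorem even_finrank_Hom_mul_middle {d m : ℕ} (hI : m + d + m = Fintype.card I) (hm : Odd m) {v : HT K I}
    (hv : v ∈ Hom K I Finset.univ d) :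
    Even (Module.finrank K ((Hom K I Finset.univ m).map (LinearMap.mulRight K v))) := by
  classical
  rw [← rank_gmat K hI hv]
  refine even_rank_of_alt K (gmat K I v m) (fun S T => ?_) (fun S => gmat_diag K hm.pos hv S)
  rw [gmat_swap K hv S T, Odd.neg_one_pow (hm.mul hm), neg_one_mul]

end Parity

/-- **PARITY LAW AT THE SELF-DUAL DEGREE** (every field, every `n`): for `v ∈ ⋀^d(K^{2n})`, `m + d + m = 2n` and `m` ODD,
`dim range(θ ↦ θ ∧ v ∣ ⋀^m)` is EVEN. -/
theorem even_finrank_range_wedge_middle (K : Type*) [Field K] {n d m : ℕ} (h : m + d + m = n + n) (hm : Odd m)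
    {v : HT K (In n)} (hv : v ∈ Hom K (In n) Finset.univ d) :
    Even (Module.finrank K (LinearMap.range (wedge K n m v))) := by
  have hI : m + d + m = Fintype.card (In n) := by rw [h, Fintype.card_fin]
  rw [range_wedge]
  exact even_finrank_Hom_mul_middle K hI hm hv

end Summit.Ventures.HSemireg.Wedge.Hankel

namespace Summit.Ventures.HSemireg.Wedge.WeilPurity

open Module Summit.Ventures.HSemireg.Wedge.Weil
open Summit.Ventures.HSemireg.Wedge.Hankel hiding Φ isoQ Φ_ι

/-- **W-PURITY STEP 1 for the Weil class** (type `(n,n)`, `n` ODD, ANY `q` — any Hankel rank ρ —, ANY `a, b`, any field):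
the degree-`n` rank of `θ ↦ θ ∧ vW` is EVEN; in particular every rank drop on a purity locus at odd `n` is even
(FORMULA-N PART B §L.5 double branches; n = 3: 94 → 92 / 112 → 110, n = 5: 1254 → 1252). -/
theorem weilRank_nn_middle_even (K : Type*) [Field K] {n : ℕ} (hn : Odd n) (q : ℕ → K) (a b : K) :
    Even (Module.finrank K (LinearMap.range (wedge K (n + n) n (vW K (n + n) n q a b)))) :=
  even_finrank_range_wedge_middle K (by omega) hn (vW_nn_mem_Hom K n q a b)

end Summit.Ventures.HSemireg.Wedge.WeilPurity
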